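import Literature.Analysis.FunctionSpaces.PoissonMecke
import Literature.Analysis.FunctionSpaces.PointConfigKernel
import Mathlib.Probability.Kernel.Composition.MeasureCompProd
import Mathlib.MeasureTheory.Constructions.Pi
import HarnessLib

/-!
# Towards the Mecke equation from Kingman's axioms, I: configurations on second countable
# Hausdorff spaces, the s-finite counting kernel, insertion of points
(trunk T-KINETIC; topic Analysis/FunctionSpaces, next to `PoissonMecke`; proofs towards the named
fact `Literature.Analysis.FunctionSpaces.IsPoissonPointProcess.multivariateMecke`,
Last–Penrose 2017 Thm 4.4, the last undischarged input of
`Literature.MathematicalPhysics.KineticTheory.gallavotti_spohn_lorentz`)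

For a Poisson point process given by Kingman's axioms (`Literature.IsPoissonPointProcess ν P`: a law
`P` on locally finite simple configurations with Poisson counts on sets of finite intensity and
independence over disjoint sets) on a second countable Hausdorff Borel space `E` with σ-finite
intensity `ν`, the Mecke equation is a statement about the *Campbell measure*
`C_P(B) = 𝔼 ∑_{a ∈ c} 1_B(c, a)`. This file supplies the measure-theoretic groundwork, without
introducing new definitions (everything is phrased with Mathlib's kernels and the tree's
`PointConfig.toMeasure`, `PointConfig.count`, `PointConfig.ofFn`):

* `PointConfig.isClosed_carrier`: a locally finite configuration in a first countable Hausdorff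
  space is closed (a convergent sequence together with its limit is compact), hence Borel
  (`measurableSet_carrier'`), so that `c.toMeasure s = N_c(s)` (`toMeasure_apply'`) holds without
  the σ-compactness assumed in `PointConfigKernel`; on sets of finite count the configuration is
  countable and `∫⁻ f d(c.toMeasure) = ∑_{a ∈ c} f a` (`lintegral_toMeasure'`).
* `PointConfig.measurableSet_mem`: `{(a, c) | a ∈ c}` is measurable (closedness and a countable
  basis: `a ∈ c ↔ ∀ basic U ∋ a, N_c(U) ≥ 1`); hence insertion of points
  `(x, c) ↦ c ∪ {x₁, …, x_m}` is measurable (`measurable_union_ofFn`, via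
  `N_{c ∪ {a}}(s) = N_c(s) + 1{a ∈ s ∖ c}`, `count_union_ofFn_one`) — the map `η ↦ η + δ_x` of
  Last–Penrose (4.10).
* `PointConfig.exists_sFiniteKernel`: for a measurable cover `(S_n)` of `E` there is an
  **s-finite kernel** `κ` from configurations to `E` with `κ c = c.toMeasure` whenever all
  `N_c(S_n) < ∞` (and `κ c = 0` otherwise); for the spanning sets of a σ-finite intensity this
  holds `P`-a.s., so `P ⊗ₘ κ` is the Campbell measure and Mathlib's kernel calculus
  (`Measure.lintegral_compProd`, measurability of kernel integrals) applies.
* Consequences of the axioms: the intensity has no atoms of finite mass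
  (`IsPoissonPointProcess.measure_singleton_eq_zero`, discharging the named fact
  `IsPoissonPointProcess.measure_singleton` as `measure_singleton_holds`), a fixed point is a.s.
  not a point of the process (`measure_setOf_mem_eq_zero`), and the mean `𝔼 N(s) = ν(s)`
  (`lintegral_count`, from the Poisson marginal and `∑ k e^{-r} rᵏ/k! = r`,
  `hasSum_poisson_mean`). (Last–Penrose 2017, §2–§4; Kingman 1993, §2.1.)

## References

* G. Last, M. Penrose, *Lectures on the Poisson Process*, Cambridge Univ. Press (2017), Ch. 2–4,
  Thm 4.1, Thm 4.4.
* J. F. C. Kingman, *Poisson Processes*, Oxford (1993), §2.1.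
-/

open MeasureTheory ProbabilityTheory Filter Set TopologicalSpace
open scoped ENNReal NNReal Topology

namespace Literature.Analysis.FunctionSpaces

namespace PointConfig

variable {E : Type*} [TopologicalSpace E]

/-! ## Configurations are closed; countability on sets of finite count -/

/-- **A locally finite configuration in a first countable Hausdorff space is closed**: if points
`xₙ ∈ c` converge to `p`, the compact set `{xₙ} ∪ {p}` meets `c` in a finite set, so `(xₙ)` takes
some value `b ∈ c` infinitely often and `p = b ∈ c`. [folklore] -/
theorem isClosed_carrier [T2Space E] [FirstCountableTopology E] (c : PointConfig E) :
    IsClosed (c : Set E) := by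
  refine IsSeqClosed.isClosed fun x p hx hp => ?_
  have hK : IsCompact (insert p (Set.range x)) := hp.isCompact_insert_range
  have hsub : Set.range x ⊆ c.carrier ∩ insert p (Set.range x) := by
    rintro y ⟨n, rfl⟩
    exact ⟨hx n, Or.inr ⟨n, rfl⟩⟩
  have hfin : (Set.range x).Finite := (c.finite_inter_isCompact _ hK).subset hsub
  haveI : Finite (Set.range x) := hfin.to_subtype
  obtain ⟨⟨b, hb⟩, hinf⟩ := Finite.exists_infinite_fiber (Set.rangeFactorization x)
  have hset : Set.rangeFactorization x ⁻¹' {⟨b, hb⟩} = {n | x n = b} := by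
    ext n
    simp [Set.rangeFactorization, Subtype.ext_iff]
  have hinf' : Set.Infinite {n : ℕ | x n = b} := by
    rw [← hset]
    exact Set.infinite_coe_iff.1 hinf
  have hfreq : ∃ᶠ n in atTop, x n = b := Nat.frequently_atTop_iff_infinite.2 hinf'
  have hpb : p = b := tendsto_nhds_unique_of_frequently_eq hp tendsto_const_nhds hfreq
  obtain ⟨n, hn⟩ := hb
  rw [hpb, ← hn]
  exact hx n

/-- The set of points of a configuration is Borel measurable (it is closed; no σ-compactness
needed, unlike `PointConfig.measurableSet_carrier`). [folklore] -/
theorem measurableSet_carrier' [T2Space E] [FirstCountableTopology E] [MeasurableSpace E]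
    [OpensMeasurableSpace E] (c : PointConfig E) : MeasurableSet (c : Set E) :=
  c.isClosed_carrier.measurableSet

/-- `c.toMeasure s = N_c(s)` on a first countable Hausdorff space (cf. `PointConfig.toMeasure_apply`,
which assumes σ-compactness). [folklore] -/
theorem toMeasure_apply' [T2Space E] [FirstCountableTopology E] [MeasurableSpace E]
    [OpensMeasurableSpace E] (c : PointConfig E) {s : Set E} (hs : MeasurableSet s) :
    c.toMeasure s = c.count s := by
  rw [toMeasure, Measure.restrict_apply hs, Measure.count_apply (hs.inter c.measurableSet_carrier'),
    count, inter_comm]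
  rfl

/-- A configuration with finite counts on a countable cover of the space is countable. [folklore] -/
theorem countable_of_count_lt_top (c : PointConfig E) {S : ℕ → Set E} (hS : (⋃ n, S n) = univ)
    (h : ∀ n, c.count (S n) < ⊤) : (c : Set E).Countable := by
  have : (c : Set E) = ⋃ n, (c.carrier ∩ S n) := by
    rw [← inter_iUnion, hS, inter_univ]; rfl
  rw [this]
  exact countable_iUnion fun n => (Set.encard_lt_top_iff.mp (h n)).countable

/-- For a countable configuration, integration against `c.toMeasure` is summation over its
points (cf. `PointConfig.lintegral_toMeasure`). [folklore] -/
theorem lintegral_toMeasure' [MeasurableSpace E] [MeasurableSingletonClass E] (c : PointConfig E)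
    (hc : (c : Set E).Countable) (f : E → ℝ≥0∞) :
    ∫⁻ a, f a ∂c.toMeasure = ∑' a : (c : Set E), f a := by
  rw [toMeasure, lintegral_countable f hc]
  simp

/-! ## Membership and insertion of points are measurable -/

section Insert

variable [T2Space E] [SecondCountableTopology E] [MeasurableSpace E] [OpensMeasurableSpace E]

/-- **Membership is jointly measurable**: `{(a, c) | a ∈ c}` is a measurable subset of
`E × PointConfig E` for the count σ-algebra (second countable Hausdorff `E`): configurations are
closed, so `a ∈ c ↔ ∀ U ∋ a` in a countable basis, `N_c(U) ≥ 1`. [folklore] -/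
theorem measurableSet_mem : MeasurableSet {p : E × PointConfig E | p.1 ∈ p.2} := by
  obtain ⟨b, hbc, -, hb⟩ := TopologicalSpace.exists_countable_basis E
  have key : {p : E × PointConfig E | p.1 ∈ p.2} =
      ⋂ U ∈ b, ({p : E × PointConfig E | p.1 ∉ U} ∪ {p | 1 ≤ p.2.count U}) := by
    ext p
    simp only [mem_setOf_eq, mem_iInter]
    constructor
    · intro hp U hU
      by_cases hpU : p.1 ∈ U
      · right
        change 1 ≤ p.2.count U
        rw [Order.one_le_iff_ne_zero, count, Ne, Set.encard_eq_zero, ← Ne, ← nonempty_iff_ne_empty]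
        exact ⟨p.1, hp, hpU⟩
      · exact Or.inl hpU
    · intro h
      have hcl : p.1 ∈ closure (p.2 : Set E) := by
        rw [hb.mem_closure_iff]
        intro U hU hpU
        rcases h U hU with h' | h'
        · exact absurd hpU h'
        · change 1 ≤ p.2.count U at h'
          rw [Order.one_le_iff_ne_zero, count, Ne, Set.encard_eq_zero, ← Ne, ← nonempty_iff_ne_empty] at h'
          obtain ⟨y, hy, hyU⟩ := h'
          exact ⟨y, hyU, hy⟩
      rwa [p.2.isClosed_carrier.closure_eq] at hcl
  rw [key]
  refine MeasurableSet.biInter hbc fun U hU => ?_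
  have hUo : IsOpen U := hb.isOpen hU
  exact ((hUo.measurableSet.compl).preimage measurable_fst).union
    (((measurable_count hUo.measurableSet).comp measurable_snd)
      (MeasurableSpace.measurableSet_top : MeasurableSet {n : ℕ∞ | 1 ≤ n}))

/-- Measurability of `{x | f x ∈ g x}` for measurable `f : α → E`, `g : α → PointConfig E`.
[folklore] -/
theorem measurableSet_mem_comp {α : Type*} [MeasurableSpace α] {f : α → E} (hf : Measurable f)
    {g : α → PointConfig E} (hg : Measurable g) : MeasurableSet {a | f a ∈ g a} :=
  measurableSet_mem.preimage (hf.prodMk hg)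

omit [T2Space E] [SecondCountableTopology E] [MeasurableSpace E] [OpensMeasurableSpace E] in
/-- Counting after inserting one point: `N_{c ∪ {a}}(s) = N_c(s) + 1{a ∈ s, a ∉ c}`
(the counting function of `η + δ_a`, Last–Penrose (4.10), for simple configurations). [folklore] -/
theorem count_union_ofFn_one (c : PointConfig E) (a : E) (s : Set E) [Decidable (a ∈ s ∧ a ∉ c)] :
    (c ∪ PointConfig.ofFn (fun _ : Fin 1 => a)).count s =
      c.count s + if a ∈ s ∧ a ∉ c then 1 else 0 := by
  have hcar : (c ∪ PointConfig.ofFn (fun _ : Fin 1 => a)).carrier = c.carrier ∪ {a} := by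
    rw [carrier_union, carrier_ofFn]
    congr 1
    ext y
    simp [eq_comm]
  rw [count, count, hcar, union_inter_distrib_right]
  split_ifs with h
  · rw [Set.encard_union_eq]
    · rw [show ({a} : Set E) ∩ s = {a} from inter_eq_left.2 (singleton_subset_iff.2 h.1), encard_singleton]
    · exact Disjoint.mono inter_subset_left inter_subset_left
        (disjoint_singleton_right.2 h.2)
  · have : ({a} : Set E) ∩ s ⊆ c.carrier ∩ s := by
      intro y hy
      rw [mem_inter_iff, mem_singleton_iff] at hy
      rcases hy with ⟨rfl, hys⟩
      by_cases hyc : y ∈ c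
      · exact ⟨hyc, hys⟩
      · exact absurd ⟨hys, hyc⟩ h
    rw [union_eq_left.2 this, add_zero]

/-- **Inserting a point is measurable**: `(a, c) ↦ c ∪ {a}` is measurable (its counting maps are
`N_c(s) + 1{a ∈ s ∖ c}`, measurable by `measurableSet_mem`). [folklore] -/
theorem measurable_union_ofFn_one :
    Measurable fun p : E × PointConfig E => p.2 ∪ PointConfig.ofFn (fun _ : Fin 1 => p.1) := by
  classical
  refine measurable_of_count fun s hs => ?_
  simp_rw [count_union_ofFn_one]
  refine ((measurable_count hs).comp measurable_snd).add (Measurable.ite ?_ measurable_const measurable_const)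
  exact (hs.preimage measurable_fst).inter measurableSet_mem.compl

omit [SecondCountableTopology E] [MeasurableSpace E] [OpensMeasurableSpace E] [T2Space E] in
/-- Inserting the points `x₀, x₁, …, x_m` is inserting `x₁, …, x_m` and then `x₀`. [folklore] -/
theorem union_ofFn_cons (c : PointConfig E) {m : ℕ} (a : E) (y : Fin m → E) :
    c ∪ PointConfig.ofFn (Fin.cons a y : Fin (m + 1) → E) =
      (c ∪ PointConfig.ofFn y) ∪ PointConfig.ofFn (fun _ : Fin 1 => a) := by
  ext z
  simp only [mem_union, mem_ofFn]
  constructor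
  · rintro (h | ⟨i, rfl⟩)
    · exact Or.inl (Or.inl h)
    · refine Fin.cases ?_ (fun j => ?_) i
      · exact Or.inr ⟨0, by simp⟩
      · exact Or.inl (Or.inr ⟨j, by simp⟩)
  · rintro ((h | ⟨j, rfl⟩) | ⟨_, rfl⟩)
    · exact Or.inl h
    · exact Or.inr ⟨j.succ, by simp⟩
    · exact Or.inr ⟨0, by simp⟩

omit [SecondCountableTopology E] [MeasurableSpace E] [OpensMeasurableSpace E] [T2Space E] in
/-- Inserting no point does nothing. [folklore] -/
theorem union_ofFn_zero (c : PointConfig E) (y : Fin 0 → E) : c ∪ PointConfig.ofFn y = c := by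
  ext z
  simp only [mem_union, mem_ofFn, or_iff_left_iff_imp]
  rintro ⟨i, -⟩
  exact i.elim0

/-- **Inserting `m` points is jointly measurable**: `(x, c) ↦ c ∪ {x₁, …, x_m}` is measurable on
`(Fin m → E) × PointConfig E` (induction on `m` with `measurable_union_ofFn_one`; this is the
measurability of `η + δ_{x₁} + ⋯ + δ_{x_m}` in the multivariate Mecke equation, Last–Penrose (4.11)).
[folklore] -/
theorem measurable_union_ofFn (m : ℕ) :
    Measurable fun p : (Fin m → E) × PointConfig E => p.2 ∪ PointConfig.ofFn p.1 := by
  induction m with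
  | zero =>
    simp_rw [union_ofFn_zero]
    exact measurable_snd
  | succ m ih =>
    have heq : (fun p : (Fin (m + 1) → E) × PointConfig E => p.2 ∪ PointConfig.ofFn p.1) =
        fun p => (p.2 ∪ PointConfig.ofFn (fun i : Fin m => p.1 i.succ)) ∪
          PointConfig.ofFn (fun _ : Fin 1 => p.1 0) := by
      funext p
      conv_lhs => rw [← Fin.cons_self_tail p.1]
      exact union_ofFn_cons p.2 (p.1 0) (Fin.tail p.1)
    rw [heq]
    have h1 : Measurable fun p : (Fin (m + 1) → E) × PointConfig E => p.1 0 :=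
      (measurable_pi_apply 0).comp measurable_fst
    have h2 : Measurable fun p : (Fin (m + 1) → E) × PointConfig E => ((fun i : Fin m => p.1 i.succ), p.2) :=
      (measurable_pi_iff.2 fun i => (measurable_pi_apply (Fin.succ i)).comp measurable_fst).prodMk
        measurable_snd
    have h3 : Measurable fun p : (Fin (m + 1) → E) × PointConfig E =>
        p.2 ∪ PointConfig.ofFn (fun i : Fin m => p.1 i.succ) := ih.comp h2
    exact measurable_union_ofFn_one.comp (h1.prodMk h3)

end Insert

/-! ## The counting kernel, s-finite on configurations with finite counts on a spanning sequence -/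

section Kernel

variable [T2Space E] [SecondCountableTopology E] [MeasurableSpace E] [OpensMeasurableSpace E]

omit [T2Space E] [SecondCountableTopology E] [OpensMeasurableSpace E] in
/-- The configurations with finite counts on each set of a measurable sequence form a measurable
set. [folklore] -/
theorem measurableSet_countLtTop (S : ℕ → Set E) (hS : ∀ n, MeasurableSet (S n)) :
    MeasurableSet {c : PointConfig E | ∀ n, c.count (S n) < ⊤} := by
  have : {c : PointConfig E | ∀ n, c.count (S n) < ⊤} = ⋂ n, (fun c => c.count (S n)) ⁻¹' {⊤}ᶜ := by
    ext c; simp [lt_top_iff_ne_top]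
  rw [this]
  exact MeasurableSet.iInter fun n => (measurable_count (hS n)) (measurableSet_singleton _).compl

/-- The counting measures `c ↦ c.toMeasure` form a kernel for the count σ-algebra (its
evaluations are the counting maps; cf. `PointConfig.countKernel`, stated there under
σ-compactness). Existence form, to avoid a second definition. [cite: LastPenrose2017, Prop 2.7] -/
theorem exists_countKernel' :
    ∃ κ : Kernel (PointConfig E) E, ∀ c, κ c = c.toMeasure :=
  ⟨⟨toMeasure, Measure.measurable_of_measurable_coe _ fun s hs => by
    simp_rw [toMeasure_apply' _ hs]
    exact measurable_from_top.comp (measurable_count hs)⟩, fun _ => rfl⟩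

/-- **An s-finite counting kernel.** For a measurable cover `(S_n)` of `E` there is an s-finite
kernel `κ` from configurations to `E` with `κ c = c.toMeasure = ∑_{a ∈ c} δ_a` whenever
`N_c(S_n) < ∞` for all `n`, and `κ c = 0` otherwise: `κ` is the countable sum over the shells
`A_n = disjointed S n` and `m : ℕ` of the finite kernels "`c.toMeasure|_{A_n}` if `N_c(A_n) = m`
and all counts are finite, else `0`" (bounded by `m`). With `S` the spanning sets of a σ-finite
intensity the proviso holds a.s. and `P ⊗ₘ κ` is the Campbell measure of the process
(Last–Penrose 2017 §2.2, (2.5); Prop. 2.7). [cite: LastPenrose2017, Prop 2.7] -/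
theorem exists_sFiniteKernel (S : ℕ → Set E) (hS : ∀ n, MeasurableSet (S n)) (hSU : (⋃ n, S n) = univ) :
    ∃ κ : Kernel (PointConfig E) E, IsSFiniteKernel κ ∧
      (∀ c, (∀ n, c.count (S n) < ⊤) → κ c = c.toMeasure) ∧
      (∀ c, ¬ (∀ n, c.count (S n) < ⊤) → κ c = 0) := by
  classical
  obtain ⟨κ₀, hκ₀⟩ := exists_countKernel' (E := E)
  set G : Set (PointConfig E) := {c | ∀ n, c.count (S n) < ⊤} with hG
  have hGm : MeasurableSet G := measurableSet_countLtTop S hS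
  -- the disjoint shells
  set A : ℕ → Set E := disjointed S with hA
  have hAm : ∀ n, MeasurableSet (A n) := MeasurableSet.disjointed hS
  have hAd : Pairwise (Function.onFun Disjoint A) := disjoint_disjointed _
  have hAU : (⋃ n, A n) = univ := by rw [hA, iUnion_disjointed, hSU]
  have hAfin : ∀ c ∈ G, ∀ n, (c.carrier ∩ A n).Finite := fun c hc n =>
    (Set.encard_lt_top_iff.mp (hc n)).subset (inter_subset_inter_right _ (disjointed_subset _ _))
  -- the finite pieces
  set κ : ℕ × ℕ → Kernel (PointConfig E) E := fun p =>
    Kernel.piecewise (s := G ∩ {c : PointConfig E | c.count (A p.1) = p.2})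
      (hGm.inter (measurableSet_eq_fun (measurable_count (hAm p.1)) measurable_const))
      (κ₀.restrict (hAm p.1)) 0 with hκ
  have hκfin : ∀ p, IsFiniteKernel (κ p) := fun p => by
    refine ⟨⟨p.2, ENNReal.natCast_lt_top _, fun c => ?_⟩⟩
    rw [hκ]
    simp only [Kernel.piecewise_apply, mem_inter_iff, mem_setOf_eq]
    split_ifs with hc
    · rw [Kernel.restrict_apply' _ _ _ MeasurableSet.univ, univ_inter, hκ₀,
        toMeasure_apply' _ (hAm p.1), hc.2]
      simp
    · simp
  refine ⟨Kernel.piecewise hGm κ₀ 0, ?_, fun c hc => by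
      rw [Kernel.piecewise_apply, if_pos (show c ∈ G from hc), hκ₀],
    fun c hc => by rw [Kernel.piecewise_apply, if_neg (show c ∉ G from hc)]; rfl⟩
  have hsum : Kernel.sum κ = Kernel.piecewise hGm κ₀ 0 := by
    ext c s hs
    rw [Kernel.sum_apply' _ _ hs, Kernel.piecewise_apply]
    by_cases hcG : c ∈ G
    · rw [if_pos hcG, hκ₀]
      have hinner : ∀ n, ∑' m, κ (n, m) c s = c.toMeasure (A n ∩ s) := fun n => by
        obtain ⟨m₀, hm₀⟩ : ∃ m₀ : ℕ, c.count (A n) = m₀ := by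
          have hlt : c.count (A n) < ⊤ := by
            rw [count]; exact (hAfin c hcG n).encard_lt_top
          exact ENat.ne_top_iff_exists.1 hlt.ne |>.imp fun m hm => hm.symm
        rw [tsum_eq_single m₀]
        · rw [hκ]
          simp only [Kernel.piecewise_apply, mem_inter_iff, mem_setOf_eq, hm₀, hcG, true_and, if_true]
          rw [Kernel.restrict_apply' _ _ _ hs, hκ₀, inter_comm]
        · intro m hm
          rw [hκ]
          simp only [Kernel.piecewise_apply, mem_inter_iff, mem_setOf_eq, hm₀, hcG, true_and]
          rw [if_neg (fun h => hm (by exact_mod_cast h.symm))]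
          simp
      rw [ENNReal.tsum_prod', tsum_congr hinner,
        ← measure_iUnion (fun i j hij => (hAd hij).mono inter_subset_left inter_subset_left)
        (fun n => (hAm n).inter hs), ← iUnion_inter, hAU, univ_inter]
    · rw [if_neg hcG]
      have hzero : ∀ p, κ p c s = 0 := fun p => by
        rw [hκ]
        simp only [Kernel.piecewise_apply, mem_inter_iff, mem_setOf_eq]
        rw [if_neg (fun h => hcG h.1)]
        simp
      simp [hzero]
  rw [← hsum]
  infer_instance

end Kernel

end PointConfig

/-! ## Three consequences of Kingman's axioms: atomless intensity, fixed points are a.s. avoided,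
the mean of the counts -/

namespace IsPoissonPointProcess

variable {E : Type*} [TopologicalSpace E] [MeasurableSpace E] {ν : Measure E} {P : Measure (PointConfig E)}

/-- **The intensity of a simple Poisson process has no atoms of finite mass**: `N({a}) ≤ 1`
surely, while `N({a}) ~ Po(ν{a})` gives `P(N({a}) = 2) = e^{-ν{a}} ν{a}²/2`, so `ν{a} = 0`
(Kingman 1993 §2.1–2.2; cf. Last–Penrose 2017 Ch. 6: a Poisson process is simple iff its
intensity is diffuse). [cite: Kingman1993, §2.1–2.2] -/
theorem measure_singleton_eq_zero (h : IsPoissonPointProcess ν P) {a : E}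
    (ha : MeasurableSet ({a} : Set E)) (hfin : ν {a} ≠ ∞) : ν {a} = 0 := by
  by_contra hne
  set r : ℝ≥0 := (ν {a}).toNNReal with hr
  have hrpos : 0 < (r : ℝ) := by
    have : 0 < r := ENNReal.toNNReal_pos hne hfin
    exact_mod_cast this
  -- `N({a}) ≤ 1`, so the event `N({a}) = 2` is empty
  have h2 : P {c : PointConfig E | c.count {a} = 2} = 0 := by
    have hle : ∀ c : PointConfig E, c.count {a} ≤ 1 := fun c => by
      rw [PointConfig.count, ← Set.encard_singleton a]
      exact Set.encard_le_encard inter_subset_right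
    have : {c : PointConfig E | c.count {a} = 2} = ∅ := by
      ext c
      simp only [mem_setOf_eq, mem_empty_iff_false, iff_false]
      intro hc
      have := hle c
      rw [hc] at this
      exact absurd this (by decide)
    rw [this, measure_empty]
  -- but it has Poisson probability `e^{-r} r² / 2 > 0`
  have h2' : P {c : PointConfig E | c.count {a} = 2} = poissonMeasure r {2} := by
    rw [show {c : PointConfig E | c.count {a} = 2} = (fun c => c.count {a}) ⁻¹' {(2 : ℕ∞)} from rfl,
      ← Measure.map_apply (PointConfig.measurable_count ha) (measurableSet_singleton _), h.map_count ha hfin,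
      Measure.map_apply measurable_from_top (measurableSet_singleton _)]
    have : ((↑) : ℕ → ℕ∞) ⁻¹' {(2 : ℕ∞)} = {2} := by
      ext n
      simp only [mem_preimage, mem_singleton_iff]
      norm_cast
    rw [this]
  rw [h2', poissonMeasure_singleton, ENNReal.ofReal_eq_zero] at h2
  have : 0 < Real.exp (-(r : ℝ)) * (r : ℝ) ^ 2 / (Nat.factorial 2 : ℝ) := by positivity
  linarith

/-- For a σ-finite intensity every measurable singleton is null (`measure_singleton_eq_zero`; a
singleton lies in a spanning set of finite mass). [cite: Kingman1993, §2.1–2.2] -/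
theorem measure_singleton_eq_zero' [SigmaFinite ν] (h : IsPoissonPointProcess ν P) {a : E}
    (ha : MeasurableSet ({a} : Set E)) : ν {a} = 0 := by
  refine h.measure_singleton_eq_zero ha (ne_top_of_le_ne_top (measure_spanningSets_lt_top ν _).ne
    (measure_mono (singleton_subset_iff.2 (mem_spanningSetsIndex ν a))))

/-- Discharge of the named fact `IsPoissonPointProcess.measure_singleton` (`PoissonPointProcess`):
the intensity of a simple Poisson process has no atoms of finite mass
(`measure_singleton_eq_zero`). [cite: Kingman1993, §2.1–2.2] -/
theorem measure_singleton_holds : measure_singleton (ν := ν) (P := P) :=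
  fun h _ hx hfin => h.measure_singleton_eq_zero hx hfin

/-- **A fixed point is almost surely not a point of the process**: `P{c | a ∈ c} = 0` for a
σ-finite intensity (the void probability of `{a}` is `e^{-ν{a}} = 1`). This is why
`η + δ_a` and `c ∪ {a}` agree a.e. in the Mecke equation for simple configurations. [folklore] -/
theorem measure_setOf_mem_eq_zero [SigmaFinite ν] (h : IsPoissonPointProcess ν P) {a : E}
    (ha : MeasurableSet ({a} : Set E)) : P {c : PointConfig E | a ∈ c} = 0 := by
  haveI := h.isProbabilityMeasure
  have h0 : P {c : PointConfig E | c.count {a} = 0} = 1 := by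
    rw [h.measure_count_eq_zero ha (by rw [h.measure_singleton_eq_zero' ha]; exact ENNReal.zero_ne_top),
      h.measure_singleton_eq_zero' ha]
    simp
  have hset : {c : PointConfig E | a ∈ c} = {c : PointConfig E | c.count {a} = 0}ᶜ := by
    ext c
    simp only [mem_setOf_eq, mem_compl_iff, PointConfig.count, Set.encard_eq_zero]
    rw [← Ne, ← nonempty_iff_ne_empty]
    constructor
    · exact fun hc => ⟨a, hc, rfl⟩
    · rintro ⟨b, hb, hba⟩
      rw [mem_singleton_iff] at hba
      exact hba ▸ hb
  have hm : MeasurableSet {c : PointConfig E | c.count {a} = 0} :=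
    PointConfig.measurable_count ha (measurableSet_singleton 0)
  rw [hset, prob_compl_eq_zero_iff hm, h0]

/-- The mean of the Poisson distribution: `∑ₖ k e^{-r} rᵏ/k! = r` (shift `k ↦ k + 1` in
`∑ₖ e^{-r} rᵏ/k! = 1`). [folklore] -/
theorem hasSum_poisson_mean (r : ℝ≥0) :
    HasSum (fun k : ℕ => (k : ℝ) * (Real.exp (-r) * (r : ℝ) ^ k / k.factorial)) r := by
  set f : ℕ → ℝ := fun k => (k : ℝ) * (Real.exp (-r) * (r : ℝ) ^ k / k.factorial) with hf
  have hshift : ∀ k : ℕ, f (k + 1) = (r : ℝ) * (Real.exp (-r) * (r : ℝ) ^ k / k.factorial) := fun k => by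
    rw [hf]
    dsimp only
    rw [Nat.factorial_succ, pow_succ]
    push_cast
    have hk : (k.factorial : ℝ) ≠ 0 := by positivity
    field_simp
  have h1 : HasSum (fun k => f (k + 1)) ((r : ℝ) - f 0) := by
    simp_rw [hshift]
    have : f 0 = 0 := by rw [hf]; simp
    rw [this, sub_zero]
    simpa using (hasSum_one_poissonMeasure r).mul_left (r : ℝ)
  refine (hasSum_nat_add_iff' 1).1 ?_
  simpa using h1

/-- **The intensity is the mean measure**: `𝔼 N(s) = ν(s)` for measurable `s` of finite
intensity (Last–Penrose 2017 (3.?)/Kingman 1993 §2.1: the Poisson marginal has mean `ν(s)`).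
[cite: Kingman1993, §2.1] -/
theorem lintegral_count (h : IsPoissonPointProcess ν P) {s : Set E} (hs : MeasurableSet s)
    (hfin : ν s ≠ ∞) : ∫⁻ c, ((c.count s : ℕ∞) : ℝ≥0∞) ∂P = ν s := by
  set r : ℝ≥0 := (ν s).toNNReal with hr
  have hmeas := PointConfig.measurable_count (E := E) hs
  calc ∫⁻ c, ((c.count s : ℕ∞) : ℝ≥0∞) ∂P
      = ∫⁻ n : ℕ∞, (n : ℝ≥0∞) ∂(P.map fun c => c.count s) := by
        rw [lintegral_map measurable_from_top hmeas]
    _ = ∫⁻ n : ℕ∞, (n : ℝ≥0∞) ∂((poissonMeasure r).map ((↑) : ℕ → ℕ∞)) := by rw [h.map_count hs hfin]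
    _ = ∫⁻ k : ℕ, ((k : ℕ∞) : ℝ≥0∞) ∂(poissonMeasure r) := by
        rw [lintegral_map measurable_from_top measurable_from_top]
    _ = ∑' k : ℕ, ((k : ℕ∞) : ℝ≥0∞) * poissonMeasure r {k} := lintegral_countable' _
    _ = ∑' k : ℕ, ENNReal.ofReal ((k : ℝ) * (Real.exp (-r) * (r : ℝ) ^ k / k.factorial)) := by
        refine tsum_congr fun k => ?_
        rw [poissonMeasure_singleton, ENNReal.ofReal_mul (Nat.cast_nonneg _)]
        congr 1
        rw [ENat.toENNReal_coe, ENNReal.ofReal_natCast]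
    _ = ENNReal.ofReal (r : ℝ) := by
        rw [← ENNReal.ofReal_tsum_of_nonneg (fun k => by positivity) (hasSum_poisson_mean r).summable,
          (hasSum_poisson_mean r).tsum_eq]
    _ = ν s := by rw [ENNReal.ofReal_coe_nnreal, hr, ENNReal.coe_toNNReal hfin]

end IsPoissonPointProcess

end Literature.Analysis.FunctionSpaces
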